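import Summits.BirchSwinnertonDyer.BirchSwinnertonDyer.Theorems.GenusKolyvaginAtTwoShaCardDvdPowAtTwoRTAntiSymmetrisation
import Summits.BirchSwinnertonDyer.BirchSwinnertonDyer.Theorems.GenusKolyvaginAtTwoShaCardDvdPowAtTwoRTRelaxedIndexShaOnHabitat
import Literature.NumberTheory.EllipticCurves.ShaRestrictionJZeroDescent
import HarnessLib

/-!
# Route `GenusKolyvaginAtTwo`, crux U_T `ShaCardDvdPowAtTwoRT` (stmt-BirchSwinnertonDyer-23658), LINE 19 `rational_pair_descent`:
# the declared RESIDUAL off the `2`-Selmer-minimal twin REDUCES TO THE `ℚ`-PAIR BOUND when `ord₂ C(Wd) ≤ 1` —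
# `#Ш(E/ℚ)[2^∞] · #Ш(E^(d_K)/ℚ)[2^∞] ≤ 4^M₀ ⟹ #Ш(E/K)[2^∞] ∣ 4^M₀` (no `#Sel₂(Wd) = 2`)

Seat `bsd-line-gk2-p3` g26 (PROVER seat 3/3, cell `bsd-f1-sign2`), `--supports stmt-BirchSwinnertonDyer-23658` (helper; closes nothing).
THEOREMS ONLY (no definition, no named fact, no `sorry`); standard axioms.  BSD is NOT proved by any of this; U_T is NOT proved (the pair bound
is a displayed hypothesis); no stub is closed.

WHY (LEAD gk2-p1 g19 23:18Z: «free target (ii): anything toward the RESIDUAL off the cut»).  LINE 19 v1.2 closes U_T on the live configuration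
{`w(E) = 1`, a `2`-Selmer-minimal twin `Wd` with `ord₂ C(Wd) ≤ 1`} by PAIRCOUNT (`#Ш(E/ℚ)[2^∞] ∣ 4^{M₀}`, needs `#Sel₂(Wd) = 2` through (RANKQ)) and
SANDWICH′ (`#X ∣ 2·#Ш(E/ℚ)[2^∞]`, needs `#Sel₂(Wd) = 2` through `Ш(Wd/ℚ)[2^∞] = 0` in (A)).  This file runs the SAME sandwich WITHOUT minimality:
the LEAD's anti-symmetrisation mechanism gives in general **`#(1 − τ_*)X ≤ #Ш(T/ℚ)[2^∞] · 2^{ord₂ C(Wd)}`** (`T = E^(d_K)`; the finite group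
`C = cor′(ψ_*⁻¹X)` has `C ∩ Ш(T/ℚ) ⊂ Ш(T/ℚ)[2^∞]` and index `≤ 2^{ord₂ C(T)}` over it), and with this seat's (R) (`#res⁻¹(X) ≤ #Ш(E/ℚ)[2^∞]·2^{ord₂ C(Wd)}`)
the LEAD's assembly yields `2·#X ≤ #Ш(E/ℚ)[2^∞] · #Ш(T/ℚ)[2^∞] · 4^{ord₂ C(Wd)}`.  For `ord₂ C(Wd) ≤ 1` (e.g. PRIME `|d_K|` — the supply crux's
output — where `ord₂ C(Wd) = 1` automatically): `#X ≤ 2·#Ш(E/ℚ)[2^∞]·#Ш(T/ℚ)[2^∞]`, and since `#X = 4^t` is a square, the PAIR BOUND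
`#Ш(E/ℚ)[2^∞]·#Ш(T/ℚ)[2^∞] ≤ 4^{M₀}` gives U_T's conclusion `#X ∣ 4^{M₀}`.  READING FOR THE PLANNERS: on {`w = 1`, `ord₂ C(Wd) ≤ 1`} the residual
«twin not `2`-Selmer-minimal» is NOT conjecture-shaped — it is EXACTLY Kolyvagin's `ℚ`-PAIR count at `2` (`#Ш(E)(2)·#Ш(E^(d_K))(2) ≤ 4^{M₀}`, the
CM cell's T4 telescope `KolyvaginPairDataTwo.card_mul_card_le_two_pow_two_mul_of_pairData_canonical` ported to the GL₂ habitat: gk2-p4 g22's memo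
`Lines/rational-pair-descent-T4-leaves-gk2p4.md`, leaves (L1) Čebotarev, (L2) data supplier); only COMPOSITE `d_K` with `ord₂ C(Wd) ≥ 3` is the
(HD)-shaped residual of this seat's memo §4 (the slack `4^{ord₂ C(Wd) − 1}` then exceeds the one-bit square refund).

* §1 **`natCard_map_sub_conjH1Points_shaPrimary_le_mul_onHabitat`** — `#(1 − τ_*)Ш(E/K)[2^∞] ≤ #Ш(T/ℚ)[2^∞] · 2^{ord₂ C(Wd)}` on U_T's frame,
  `σ ≠ 1`, ANY elliptic model `Wd` of the twist, NO minimality, NO `w = 1` (the LEAD's p7505xx `…_le_onHabitat` proof with the `Zp = ⊥` step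
  replaced by the injection `C ∩ Ш(T/ℚ) ↪ Ш(T/ℚ)[2^∞]`).
* §2 **`natCard_sha_dvd_pow_of_pairBound_onHabitat`** — on U_T's frame with `w(E) = 1`, `σ ≠ 1`, ANY elliptic model `Wd` with `ord₂ C(Wd) ≤ 1`:
  `#Ш(E/ℚ)[2^∞] · #Ш(T/ℚ)[2^∞] ≤ 2^{2M₀} ⟹ #Ш(E/K)[2^∞] ∣ 2^{2M₀}` (`T = W.quadraticTwist (discr K)`); `…_onHabitat'` — the same with the
  pair bound read on the model `Wd` (`#Ш(Wd/ℚ)[2^∞] = #Ш(T/ℚ)[2^∞]`, `natCard_primaryComponent_sha_eq_of_variableChange`).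

References: [Kramer1981] Thm. 1, §2 Prop. 3; [GrossLMS1991] §5 (5.1)–(5.3); [Kolyvagin1989Izv] Thm. B₂, §3; [McCallumLMS1991] §5 Cor. 5.6;
[SerreGaloisCohomology1997] I §2.4 Prop. 9.
-/

set_option autoImplicit false
set_option linter.dupNamespace false -- `Summit.<P>.<Sub>` repeats `BirchSwinnertonDyer` (D-0017)

noncomputable section

open scoped Classical

namespace Summit.BirchSwinnertonDyer.BirchSwinnertonDyer.Theorems.GenusExact.PlusDescent

open Literature.NumberTheory.EllipticCurves Literature.NumberTheory.GaloisRepresentations WeierstrassCurve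
open NumberField IsDedekindDomain Field Literature.NumberTheory.EllipticCurves.ModularForms AddSubgroup
open Summit.BirchSwinnertonDyer.BirchSwinnertonDyer.Theses.GenusKolyvaginAtTwo (KolyvaginRelationAtTwo)

variable (W : WeierstrassCurve ℚ) [W.IsElliptic] [W.IsGloballyMinimal] [NeZero (W.conductorNorm ℤ)]
variable (K : Type) [Field K] [NumberField K]

/-! ## §1 The anti-symmetrisation bound without minimality -/

/-- **`#(1 − τ_*) Ш(E/K)[2^∞] ≤ #Ш(T/ℚ)[2^∞] · 2^{ord₂ C(Wd)}`, `T = E^(d_K)`, for ANY elliptic model `Wd` of the twist — NO `2`-Selmer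
minimality, NO `w(E) = 1`.**  U_T's frame (only `hndiv` of the `M₀`-clause used, for finiteness), `σ ≠ 1`.  The LEAD's mechanism
(`natCard_map_sub_conjH1Points_shaPrimary_le_onHabitat`): `(1 − τ_*)(ψ_* s) = ψ_*(res′(cor′ s))`, `C = cor′(ψ_*⁻¹X)` is a finite group of
`2`-power-torsion classes with `res′ C ⊂ Ш(T_K)`; here `#C = #(C ∩ Ш(T/ℚ)) · [C : C ∩ Ш(T/ℚ)]` with `C ∩ Ш(T/ℚ) ↪ Ш(T/ℚ)[2^∞]` (finite,
gk2-p5 g29) and `[C : C ∩ Ш(T/ℚ)] ≤ [res′⁻¹Ш(T_K) : Ш(T/ℚ) ∩ ·] ≤ 2^{ord₂ C(T)} = 2^{ord₂ C(Wd)}` (g18).  [cite: Kramer1981, Thm. 1 and §2 Prop. 3]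
[cite: GrossLMS1991, §5 (5.1)–(5.3)] [cite: SerreGaloisCohomology1997, I §2.4 Prop. 9] -/
theorem natCard_map_sub_conjH1Points_shaPrimary_le_mul_onHabitat (hQ2 : KolyvaginRelationAtTwo) (hcm : ¬ W.HasCM)
    (hT : Odd W.tamagawaProduct) (v : HeightOneSpectrum (𝓞 ℚ)) (h2v : ((2 : ℕ) : 𝓞 ℚ) ∉ v.asIdeal)
    (hNv : ((W.conductorNorm ℤ : ℕ) : 𝓞 ℚ) ∈ v.asIdeal) (hmult : W.HasMultiplicativeReductionAt v) (hneg : W.Δ < 0)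
    (hIQ : IsImaginaryQuadratic K) (hodd : Odd (NumberField.discr K))
    (h3 : NumberField.discr K ≠ -3) (hHe : SatisfiesHeegnerHypothesis (W.conductorNorm ℤ) K)
    (hsq1 : ¬ IsSquare ((NumberField.discr K : ℚ) * -|W.Δ|)) (hsq2 : ¬ IsSquare ((NumberField.discr K : ℚ) * (-(2 * |W.Δ|))))
    (hρ : ∀ n : ℕ, 0 < n → W.HasSurjectiveModNGaloisRep ((2 : ℤ) ^ n))
    (Dt : ModularParametrizationData W (W.conductorNorm ℤ)) (β : ℤ) (ι : K →+* ℂ) (d₁ : KolyvaginHeegnerData Dt β ι 1) (M₀ : ℕ)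
    (hndiv : ¬ ∃ Q : (W.baseChange (ringClassField K ι 1)).toAffine.Point, ((2 ^ (M₀ + 1) : ℕ) : ℤ) • Q = d₁.derivedPoint)
    {σ : K ≃ₐ[ℚ] K} (hσ1 : σ ≠ 1)
    {Wd : WeierstrassCurve ℚ} [Wd.IsElliptic] (Cd : VariableChange ℚ) (hWd : Cd • W.quadraticTwist (NumberField.discr K : ℚ) = Wd) :
    haveI := W.isElliptic_quadraticTwist (show (NumberField.discr K : ℚ) ≠ 0 by exact_mod_cast NumberField.discr_ne_zero K)
    Nat.card (((AddCommGroup.primaryComponent (↥(W.baseChange K).sha) 2).map (W.baseChange K).sha.subtype).map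
        (AddMonoidHom.id (W.baseChange K).galH1 - (isLiftOfAut_liftAut σ).conjH1Points W)) ≤
      Nat.card (AddCommGroup.primaryComponent (↥(W.quadraticTwist (NumberField.discr K : ℚ)).sha) 2) *
        2 ^ padicValNat 2 Wd.tamagawaProduct := by
  haveI : Fact (Nat.Prime 2) := ⟨Nat.prime_two⟩
  have h2 : Module.finrank ℚ K = 2 := hIQ.1
  have hdK : (NumberField.discr K : ℚ) ≠ 0 := by exact_mod_cast NumberField.discr_ne_zero K
  obtain ⟨τ, θ₀, hτ1, hθ₀Q, hθ₀, hτθ₀, hall⟩ := exists_gal_ne_one_sqrt_discr K h2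
  obtain rfl : σ = τ := (hall σ).resolve_left hσ1
  obtain ⟨C, hC⟩ := W.exists_variableChange_quadraticTwist_one
  haveI hTell : (W.quadraticTwist (NumberField.discr K : ℚ)).IsElliptic := W.isElliptic_quadraticTwist hdK
  have hK : ∀ w : InfinitePlace K, w.IsComplex := hIQ.2.isComplex
  -- ### the objects (as in the LEAD's (A))
  set X : AddSubgroup ↥(W.baseChange K).sha := AddCommGroup.primaryComponent (↥(W.baseChange K).sha) 2 with hX
  set Xs : AddSubgroup (W.baseChange K).galH1 := X.map (W.baseChange K).sha.subtype with hXs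
  set δ : (W.baseChange K).galH1 →+ (W.baseChange K).galH1 :=
    AddMonoidHom.id (W.baseChange K).galH1 - (isLiftOfAut_liftAut σ).conjH1Points W with hδ
  set Φ := h1Equiv (twistIso W hθ₀Q hθ₀ hC) (twistIso_smul W hθ₀Q hθ₀ hC) with hΦ
  set cor' := corBaseChange K (W.quadraticTwist (NumberField.discr K : ℚ)) σ h2 hσ1 with hcor'
  set res' := resBaseChange (W.quadraticTwist (NumberField.discr K : ℚ)) K with hres'
  -- ### the key identity `(1 − τ_*)(ψ_* s) = ψ_*(res'(cor' s))`
  have hkey : ∀ s, δ (Φ s) = Φ (res' (cor' s)) := by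
    intro s
    rw [hres', hcor', resBaseChange_corBaseChange K (W.quadraticTwist (NumberField.discr K : ℚ)) σ h2 hσ1 (isLiftOfAut_liftAut σ) s,
      map_add, hΦ, h1Equiv_twistIso_conjH1Points W hθ₀Q hθ₀ hC (isLiftOfAut_liftAut σ) hτθ₀ s, hδ, AddMonoidHom.sub_apply,
      AddMonoidHom.id_apply, sub_eq_add_neg]
  -- ### `C := cor'(ψ_*⁻¹ Xs)`
  set π : (W.baseChange K).galH1 →+ (W.quadraticTwist (NumberField.discr K : ℚ)).galH1 :=
    cor'.comp Φ.symm.toAddMonoidHom with hπ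
  have hπapp : ∀ x, Φ (res' (π x)) = δ x := fun x ↦ by
    rw [hπ, AddMonoidHom.comp_apply, AddEquiv.coe_toAddMonoidHom, ← hkey, AddEquiv.apply_symm_apply]
  set Cg := Xs.map π with hCg
  -- ### finiteness
  haveI hXfin : Finite X :=
    finite_primaryComponent_sha_two_onHabitat hQ2 W hcm hT v h2v hNv hmult hneg K hIQ hodd h3 hHe hsq1 hsq2 hρ Dt β ι d₁ M₀ hndiv
  haveI hXsfin : Finite Xs := by
    have h : (Xs : Set (W.baseChange K).galH1).Finite := by
      rw [hXs, AddSubgroup.coe_map]; exact (Set.toFinite _).image _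
    exact h.to_subtype
  haveI hCfin : Finite Cg := by
    have h : (Cg : Set (W.quadraticTwist (NumberField.discr K : ℚ)).galH1).Finite := by
      rw [hCg, AddSubgroup.coe_map]; exact (Set.toFinite _).image _
    exact h.to_subtype
  haveI hYTfin : Finite (AddCommGroup.primaryComponent (↥(W.quadraticTwist (NumberField.discr K : ℚ)).sha) 2) :=
    finite_primaryComponent_sha_twin_two_onHabitat hQ2 W hcm hT v h2v hNv hmult hneg K hIQ hodd h3 hHe hsq1 hsq2 hρ Dt β ι d₁ M₀
      hndiv (W.quadraticTwist (NumberField.discr K : ℚ)) ⟨1, one_smul _ _⟩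
  -- ### `(1 − τ_*)Xs` is the image of `C` under `ψ_* ∘ res'`
  have hsurj : Nat.card (Xs.map δ) ≤ Nat.card Cg := by
    refine Nat.card_le_card_of_surjective (fun c : Cg ↦ (⟨Φ (res' (c : (W.quadraticTwist _).galH1)), ?_⟩ : Xs.map δ)) ?_
    · obtain ⟨x, hx, hxc⟩ := AddSubgroup.mem_map.mp c.2
      rw [← hxc, hπapp]
      exact AddSubgroup.mem_map.mpr ⟨x, hx, rfl⟩
    · rintro ⟨y, hy'⟩
      obtain ⟨x, hx, rfl⟩ := AddSubgroup.mem_map.mp hy'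
      exact ⟨⟨π x, AddSubgroup.mem_map.mpr ⟨x, hx, rfl⟩⟩, Subtype.ext (hπapp x)⟩
  -- ### `C ⊂ res'⁻¹(Ш(T_K))`
  have hCle : Cg ≤ ((W.quadraticTwist (NumberField.discr K : ℚ)).baseChange K).sha.comap res' := by
    rintro _ ⟨x, hx, rfl⟩
    have hxsha : x ∈ (W.baseChange K).sha := by
      obtain ⟨x', -, rfl⟩ := AddSubgroup.mem_map.mp hx
      exact x'.2
    have hs : Φ.symm x ∈ ((W.quadraticTwist (NumberField.discr K : ℚ)).baseChange K).sha := by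
      rw [mem_sha_iff_h1Equiv_twistIso_mem W hθ₀Q hθ₀ hC, ← hΦ, AddEquiv.apply_symm_apply]
      exact hxsha
    rw [AddSubgroup.mem_comap, hπ, AddMonoidHom.comp_apply, AddEquiv.coe_toAddMonoidHom, hres', hcor',
      resBaseChange_corBaseChange K _ σ h2 hσ1 (isLiftOfAut_liftAut σ)]
    exact AddSubgroup.add_mem _ hs (SylvesterTwoShaConjugation.conjH1Points_mem_sha _ hK (isLiftOfAut_liftAut σ) hs)
  -- ### `C ∩ Ш(T/ℚ) ↪ Ш(T/ℚ)[2^∞]` (no minimality: just count it)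
  have hinter : Nat.card (((W.quadraticTwist (NumberField.discr K : ℚ)).sha).addSubgroupOf Cg) ≤
      Nat.card (AddCommGroup.primaryComponent (↥(W.quadraticTwist (NumberField.discr K : ℚ)).sha) 2) := by
    refine Nat.card_le_card_of_injective
      (fun c ↦ (⟨⟨((c : Cg) : (W.quadraticTwist (NumberField.discr K : ℚ)).galH1), AddSubgroup.mem_addSubgroupOf.mp c.2⟩, ?_⟩ :
        AddCommGroup.primaryComponent (↥(W.quadraticTwist (NumberField.discr K : ℚ)).sha) 2)) ?_
    · obtain ⟨x, hx, hxc⟩ := AddSubgroup.mem_map.mp (c : Cg).2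
      obtain ⟨x', hx', rfl⟩ := AddSubgroup.mem_map.mp hx
      obtain ⟨k, hk⟩ := (AddCommGroup.mem_primaryComponent).mp hx'
      have h0 : 2 ^ k • ((c : Cg) : (W.quadraticTwist (NumberField.discr K : ℚ)).galH1) = 0 := by
        rw [← hxc, ← map_nsmul, AddSubgroup.coe_subtype, ← AddSubgroupClass.coe_nsmul, hk, ZeroMemClass.coe_zero, map_zero]
      exact (AddCommGroup.mem_primaryComponent).mpr
        ⟨k, Subtype.ext (by rw [AddSubgroupClass.coe_nsmul, ZeroMemClass.coe_zero]; exact h0)⟩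
    · intro a b hab
      have h := congrArg (fun z : AddCommGroup.primaryComponent (↥(W.quadraticTwist (NumberField.discr K : ℚ)).sha) 2 ↦
        ((z : ↥(W.quadraticTwist (NumberField.discr K : ℚ)).sha) : (W.quadraticTwist (NumberField.discr K : ℚ)).galH1)) hab
      exact Subtype.ext (Subtype.ext h)
  -- ### count in the twin's relaxed group
  obtain ⟨hne, hle⟩ := relIndex_sha_comap_resBaseChange_twin_le_two_pow W (K := K) hneg hIQ hodd hHe hT
    (Wd := W.quadraticTwist (NumberField.discr K : ℚ)) 1 (one_smul _ _)
  have hsplit : Nat.card (((W.quadraticTwist (NumberField.discr K : ℚ)).sha).addSubgroupOf Cg) *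
      ((W.quadraticTwist (NumberField.discr K : ℚ)).sha).relIndex Cg = Nat.card Cg := AddSubgroup.card_mul_index _
  have hCcard : Nat.card Cg ≤ Nat.card (AddCommGroup.primaryComponent (↥(W.quadraticTwist (NumberField.discr K : ℚ)).sha) 2) *
      2 ^ padicValNat 2 (W.quadraticTwist (NumberField.discr K : ℚ)).tamagawaProduct := by
    rw [← hsplit]
    exact Nat.mul_le_mul hinter ((AddSubgroup.relIndex_le_of_le_right hCle hne).trans hle)
  -- ### `ord₂ c(T) = ord₂ c(Wd)` (both equal the genus budget)
  have heq : padicValNat 2 (W.quadraticTwist (NumberField.discr K : ℚ)).tamagawaProduct = padicValNat 2 Wd.tamagawaProduct := by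
    have h1 := prod_ncard_roots_add_one_eq_two_pow_padicValNat_tamagawaProduct_twin W hIQ hodd hHe hT
      (Wd := W.quadraticTwist (NumberField.discr K : ℚ)) 1 (one_smul _ _)
    have h2' := prod_ncard_roots_add_one_eq_two_pow_padicValNat_tamagawaProduct_twin W hIQ hodd hHe hT Cd hWd
    exact Nat.pow_right_injective le_rfl (h1.symm.trans h2')
  calc Nat.card (Xs.map δ) ≤ Nat.card Cg := hsurj
    _ ≤ Nat.card (AddCommGroup.primaryComponent (↥(W.quadraticTwist (NumberField.discr K : ℚ)).sha) 2) *
          2 ^ padicValNat 2 (W.quadraticTwist (NumberField.discr K : ℚ)).tamagawaProduct := hCcard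
    _ = _ := by rw [heq]

/-! ## §2 The residual off the minimal twin ⟸ the `ℚ`-pair bound (when `ord₂ C(Wd) ≤ 1`) -/

/-- **THE RESIDUAL REDUCES TO THE `ℚ`-PAIR BOUND.**  On U_T's frame with `w(E) = 1` and `σ ≠ 1`, for ANY elliptic model `Wd ≅ E^(d_K)` with
`ord₂ C(Wd) ≤ 1` (no `2`-Selmer minimality): if `#Ш(E/ℚ)[2^∞] · #Ш(T/ℚ)[2^∞] ≤ 2^{2M₀}` (`T = W.quadraticTwist (discr K)`; Kolyvagin's
`ℚ`-pair count at `2`, DISPLAYED), then `#Ш(E/K)[2^∞] ∣ 2^{2M₀}`.  Proof: the LEAD's assembly `two_mul_natCard_sha_le_of_inputs` with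
`A = #Ш(E/ℚ)[2^∞]·2^e` (this seat's (R), `natCard_comap_resBaseChange_shaPrimary_le_two_pow_onHabitat`) and `B = #Ш(T/ℚ)[2^∞]·2^e` (§1),
`e = ord₂ C(Wd) ≤ 1`: `2·#X ≤ 4·#Ш(E/ℚ)[2^∞]·#Ш(T/ℚ)[2^∞] ≤ 4·4^{M₀}`; `#X = 4^t` (g29) forces `t ≤ M₀`.
[cite: Kramer1981, Thm. 1] [cite: GrossLMS1991, §5 (5.1)–(5.3)] [cite: Kolyvagin1989Izv, Thm. B₂ and §3] [cite: McCallumLMS1991, §5 Cor. 5.6] -/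
theorem natCard_sha_dvd_pow_of_pairBound_onHabitat (hQ2 : KolyvaginRelationAtTwo) (hcm : ¬ W.HasCM)
    (hT : Odd W.tamagawaProduct) (v : HeightOneSpectrum (𝓞 ℚ)) (h2v : ((2 : ℕ) : 𝓞 ℚ) ∉ v.asIdeal)
    (hNv : ((W.conductorNorm ℤ : ℕ) : 𝓞 ℚ) ∈ v.asIdeal) (hmult : W.HasMultiplicativeReductionAt v) (hneg : W.Δ < 0)
    (hIQ : IsImaginaryQuadratic K) (hodd : Odd (NumberField.discr K))
    (h3 : NumberField.discr K ≠ -3) (hHe : SatisfiesHeegnerHypothesis (W.conductorNorm ℤ) K)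
    (hsq1 : ¬ IsSquare ((NumberField.discr K : ℚ) * -|W.Δ|)) (hsq2 : ¬ IsSquare ((NumberField.discr K : ℚ) * (-(2 * |W.Δ|))))
    (hρ : ∀ n : ℕ, 0 < n → W.HasSurjectiveModNGaloisRep ((2 : ℤ) ^ n))
    (Dt : ModularParametrizationData W (W.conductorNorm ℤ)) (β : ℤ) (ι : K →+* ℂ) (d₁ : KolyvaginHeegnerData Dt β ι 1) (M₀ : ℕ)
    (hndiv : ¬ ∃ Q : (W.baseChange (ringClassField K ι 1)).toAffine.Point, ((2 ^ (M₀ + 1) : ℕ) : ℤ) • Q = d₁.derivedPoint)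
    (hw : W.rootNumber = 1) {σ : K ≃ₐ[ℚ] K} (hσ1 : σ ≠ 1)
    {Wd : WeierstrassCurve ℚ} [Wd.IsElliptic] (Cd : VariableChange ℚ) (hWd : Cd • W.quadraticTwist (NumberField.discr K : ℚ) = Wd)
    (hle : padicValNat 2 Wd.tamagawaProduct ≤ 1)
    (hpair : haveI := W.isElliptic_quadraticTwist (show (NumberField.discr K : ℚ) ≠ 0 by exact_mod_cast NumberField.discr_ne_zero K)
      Nat.card (AddCommGroup.primaryComponent (↥W.sha) 2) *
        Nat.card (AddCommGroup.primaryComponent (↥(W.quadraticTwist (NumberField.discr K : ℚ)).sha) 2) ≤ 2 ^ (2 * M₀)) :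
    Nat.card (AddCommGroup.primaryComponent (↥(W.baseChange K).sha) 2) ∣ 2 ^ (2 * M₀) := by
  haveI : Fact (Nat.Prime 2) := ⟨Nat.prime_two⟩
  have hdK : (NumberField.discr K : ℚ) ≠ 0 := by exact_mod_cast NumberField.discr_ne_zero K
  haveI hTell : (W.quadraticTwist (NumberField.discr K : ℚ)).IsElliptic := W.isElliptic_quadraticTwist hdK
  set Y := Nat.card (AddCommGroup.primaryComponent (↥W.sha) 2) with hY
  set Y' := Nat.card (AddCommGroup.primaryComponent (↥(W.quadraticTwist (NumberField.discr K : ℚ)).sha) 2) with hY'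
  set e := padicValNat 2 Wd.tamagawaProduct with he
  have hR := SelmerDescent.natCard_comap_resBaseChange_shaPrimary_le_two_pow_onHabitat hQ2 W hcm hT v h2v hNv hmult hneg K hIQ hodd h3
    hHe hsq1 hsq2 hρ Dt β ι d₁ M₀ hndiv hσ1 Wd ⟨Cd, hWd⟩
  have hA := natCard_map_sub_conjH1Points_shaPrimary_le_mul_onHabitat W K hQ2 hcm hT v h2v hNv hmult hneg hIQ hodd h3 hHe hsq1 hsq2 hρ
    Dt β ι d₁ M₀ hndiv hσ1 Cd hWd
  have h := two_mul_natCard_sha_le_of_inputs W K hQ2 hcm hT v h2v hNv hmult hneg hIQ hodd h3 hHe hsq1 hsq2 hρ Dt β ι d₁ M₀ hndiv hw hσ1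
    _ _ hR hA
  obtain ⟨t, ht⟩ := exists_natCard_primaryComponent_sha_two_eq_pow_two_mul_onHabitat hQ2 W hcm hT v h2v hNv hmult hneg K hIQ hodd h3 hHe
    hsq1 hsq2 hρ Dt β ι d₁ M₀ hndiv
  -- `2·4^t ≤ (Y·2^e)·(Y'·2^e) ≤ Y·Y'·4 ≤ 4·4^{M₀}`
  have h2e : 2 ^ e ≤ 2 := by
    calc 2 ^ e ≤ 2 ^ 1 := Nat.pow_le_pow_right two_pos hle
      _ = 2 := pow_one 2
  have hle' : 2 * 2 ^ (2 * t) ≤ 4 * 2 ^ (2 * M₀) := by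
    calc 2 * 2 ^ (2 * t) ≤ Y * 2 ^ e * (Y' * 2 ^ e) := by rw [← ht]; exact h
      _ = Y * Y' * (2 ^ e * 2 ^ e) := by ring
      _ ≤ 2 ^ (2 * M₀) * (2 * 2) := Nat.mul_le_mul hpair (Nat.mul_le_mul h2e h2e)
      _ = 4 * 2 ^ (2 * M₀) := by ring
  -- hence `t ≤ M₀`
  have htM : t ≤ M₀ := by
    by_contra hlt
    have hM : M₀ + 1 ≤ t := by omega
    have hpow : 2 ^ (2 * (M₀ + 1)) ≤ 2 ^ (2 * t) := Nat.pow_le_pow_right two_pos (by omega)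
    have h4 : 2 ^ (2 * (M₀ + 1)) = 4 * 2 ^ (2 * M₀) := by ring
    have hpos : 0 < 2 ^ (2 * M₀) := pow_pos two_pos _
    omega
  rw [ht]
  exact pow_dvd_pow 2 (by omega)

/-- **The residual ⟸ the pair bound, `Wd`-presentation**: as `natCard_sha_dvd_pow_of_pairBound_onHabitat` with the pair bound read on the
model `Wd` itself, `#Ш(E/ℚ)[2^∞] · #Ш(Wd/ℚ)[2^∞] ≤ 2^{2M₀}` (`ℚ`-isomorphic models have the same `#Ш[2^∞]`,
`natCard_primaryComponent_sha_eq_of_variableChange`).  [cite: Kramer1981, Thm. 1] [cite: Kolyvagin1989Izv, Thm. B₂ and §3] [cite: MilneADT2006, I Lemma 7.1] -/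
theorem natCard_sha_dvd_pow_of_pairBound_onHabitat' (hQ2 : KolyvaginRelationAtTwo) (hcm : ¬ W.HasCM)
    (hT : Odd W.tamagawaProduct) (v : HeightOneSpectrum (𝓞 ℚ)) (h2v : ((2 : ℕ) : 𝓞 ℚ) ∉ v.asIdeal)
    (hNv : ((W.conductorNorm ℤ : ℕ) : 𝓞 ℚ) ∈ v.asIdeal) (hmult : W.HasMultiplicativeReductionAt v) (hneg : W.Δ < 0)
    (hIQ : IsImaginaryQuadratic K) (hodd : Odd (NumberField.discr K))
    (h3 : NumberField.discr K ≠ -3) (hHe : SatisfiesHeegnerHypothesis (W.conductorNorm ℤ) K)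
    (hsq1 : ¬ IsSquare ((NumberField.discr K : ℚ) * -|W.Δ|)) (hsq2 : ¬ IsSquare ((NumberField.discr K : ℚ) * (-(2 * |W.Δ|))))
    (hρ : ∀ n : ℕ, 0 < n → W.HasSurjectiveModNGaloisRep ((2 : ℤ) ^ n))
    (Dt : ModularParametrizationData W (W.conductorNorm ℤ)) (β : ℤ) (ι : K →+* ℂ) (d₁ : KolyvaginHeegnerData Dt β ι 1) (M₀ : ℕ)
    (hndiv : ¬ ∃ Q : (W.baseChange (ringClassField K ι 1)).toAffine.Point, ((2 ^ (M₀ + 1) : ℕ) : ℤ) • Q = d₁.derivedPoint)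
    (hw : W.rootNumber = 1) {σ : K ≃ₐ[ℚ] K} (hσ1 : σ ≠ 1)
    {Wd : WeierstrassCurve ℚ} [Wd.IsElliptic] (Cd : VariableChange ℚ) (hWd : Cd • W.quadraticTwist (NumberField.discr K : ℚ) = Wd)
    (hle : padicValNat 2 Wd.tamagawaProduct ≤ 1)
    (hpair : Nat.card (AddCommGroup.primaryComponent (↥W.sha) 2) * Nat.card (AddCommGroup.primaryComponent (↥Wd.sha) 2) ≤ 2 ^ (2 * M₀)) :
    Nat.card (AddCommGroup.primaryComponent (↥(W.baseChange K).sha) 2) ∣ 2 ^ (2 * M₀) := by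
  haveI : Fact (Nat.Prime 2) := ⟨Nat.prime_two⟩
  have hdK : (NumberField.discr K : ℚ) ≠ 0 := by exact_mod_cast NumberField.discr_ne_zero K
  haveI hTell : (W.quadraticTwist (NumberField.discr K : ℚ)).IsElliptic := W.isElliptic_quadraticTwist hdK
  refine natCard_sha_dvd_pow_of_pairBound_onHabitat W K hQ2 hcm hT v h2v hNv hmult hneg hIQ hodd h3 hHe hsq1 hsq2 hρ Dt β ι d₁ M₀ hndiv hw
    hσ1 Cd hWd hle ?_
  rw [natCard_primaryComponent_sha_eq_of_variableChange hWd 2]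
  exact hpair

end Summit.BirchSwinnertonDyer.BirchSwinnertonDyer.Theorems.GenusExact.PlusDescent

end
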